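import Summits.AtomisticToContinuum.FouriersLaw.Theorems.BondHeatUncertaintyExtensiveSnapshotIrreversibilityEnergyWindowCostateSampling
import HarnessLib

/-!
# Bond–heat uncertainty window, part U-e: Riemann sampling of the harmonic skeleton Gram form

Cell `decomp-a2c`, lineage crux `ExtensiveSnapshotIrreversibility` (K_fix half, leaf S3
`KernelTemperatureLipschitz`), HARMONIC CALIBRATION of (SWM) `SkeletonWeightMoments` (part R),
step 3b of 4.  The normalised skeleton Gram form of the harmonic chain in the direction of a
covector `λ` is, bath by bath, a Riemann sum of squared CELL AVERAGES of the bath-momentum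
component `β_λ = (c_λ).2 b` of the harmonic costate (part U-c, `harmonic_dualPair_skelVariation_inl`
/ `_inr`).  This file bounds such Riemann sums from BELOW by the integral of the square, with an
explicit `O(2^{-m})` error (no limit is taken — the calibration needs an inequality that holds
eventually in the level `m`, uniformly in nothing else):

* §1 (`sq_integral_ge_cell`) on one cell `[a, b]`, if `β` oscillates by at most `η`,
  `½ ∫_a^b β² - (b-a) η² ≤ (b-a)⁻¹ (∫_a^b β)²`; (`sum_sq_cellIntegral_ge`) summed over the
  `⌊s 2^m⌋` full dyadic cells of `[0, s]` for an `L`-Lipschitz, `B`-bounded `β`: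
  `½ ∫₀ˢ β² - 2^{-m} (B² + s L²) ≤ Σ_{k < ⌊s2^m⌋} 2^m (∫_{I_k} β)²`;
* §2 (`harmonic_skelGramForm_ge`, `…_inl`, `…_inr`) hence, for `0 < s ≤ 1` and every level `m`,
  `2^{-m} Σ_k ⟨λ, w_{ι k}(s)⟩² ≥ amp² (½ ∫₀ˢ β_λ² - 2^{-m} E(λ))` for each bath (`ι = inl`, left,
  `amp² = 2γT_L`, `b = 0`; `ι = inr`, right, `amp² = 2γT_R`, `b = N-1`), with
  `E(λ) = B_λ² + s L_λ²`, `B_λ = ‖λ‖ e^{‖𝒢‖}`, `L_λ = ‖𝒢‖ B_λ` (part U-b §3) — quadratic in `‖λ‖`.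

No new instance / notation; no proof holes.  References: D. Nualart, *The Malliavin Calculus and
Related Topics* (2006), §2.3.1; E. D. Sontag, *Mathematical Control Theory* (1998), §3.5.
-/

noncomputable section

namespace Summit.AtomisticToContinuum.FouriersLaw.Theorems.ExtensiveSnapshotIrreversibility.EnergyWindow

open MeasureTheory Filter Topology Real unitInterval Set NormedSpace
open scoped NNReal
open Literature.MathematicalPhysics.KineticTheory.HeatConduction
open Literature.Probability.Process Literature.Analysis.ODE

/-! ## 1. Riemann sums of squared cell averages -/

section Riemann

/-- **One cell.** If `β` is continuous and oscillates by at most `η` on `[a, b]` (`a < b`), then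
`½ ∫_a^b β² - (b - a) η² ≤ (b - a)⁻¹ (∫_a^b β)²`. [folklore] -/
theorem sq_integral_ge_cell {β : ℝ → ℝ} (hβ : Continuous β) {a b η : ℝ} (hab : a < b)
    (hosc : ∀ t ∈ Icc a b, ∀ u ∈ Icc a b, |β t - β u| ≤ η) :
    (1 / 2) * (∫ t in a..b, β t ^ 2) - (b - a) * η ^ 2 ≤ (b - a)⁻¹ * (∫ t in a..b, β t) ^ 2 := by
  have hba : 0 < b - a := sub_pos.2 hab
  set y : ℝ := (b - a)⁻¹ * ∫ t in a..b, β t with hy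
  have hdev : ∀ t ∈ Icc a b, |β t - y| ≤ η := by
    intro t ht
    have h1 : β t - y = (b - a)⁻¹ * ∫ u in a..b, (β t - β u) := by
      rw [intervalIntegral.integral_sub intervalIntegrable_const (hβ.intervalIntegrable a b),
        intervalIntegral.integral_const, smul_eq_mul, hy, mul_sub, inv_mul_cancel_left₀ hba.ne']
    have h2 : ‖∫ u in a..b, (β t - β u)‖ ≤ η * |b - a| :=
      intervalIntegral.norm_integral_le_of_norm_le_const fun u hu => by
        rw [Set.uIoc_of_le hab.le] at hu
        rw [Real.norm_eq_abs]
        exact hosc t ht u ⟨hu.1.le, hu.2⟩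
    rw [Real.norm_eq_abs, abs_of_pos hba] at h2
    rw [h1, abs_mul, abs_of_pos (inv_pos.2 hba)]
    calc (b - a)⁻¹ * |∫ u in a..b, (β t - β u)| ≤ (b - a)⁻¹ * (η * (b - a)) :=
          mul_le_mul_of_nonneg_left h2 (inv_pos.2 hba).le
      _ = η := by field_simp
  have hpt : ∀ t ∈ Icc a b, β t ^ 2 ≤ 2 * y ^ 2 + 2 * η ^ 2 := by
    intro t ht
    have h := abs_le.1 (hdev t ht)
    have h' : (β t - y) ^ 2 ≤ η ^ 2 := sq_le_sq' h.1 h.2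
    nlinarith [sq_nonneg (β t - 2 * y)]
  have hmono : ∫ t in a..b, β t ^ 2 ≤ ∫ _ in a..b, (2 * y ^ 2 + 2 * η ^ 2 : ℝ) :=
    intervalIntegral.integral_mono_on hab.le ((hβ.pow 2).intervalIntegrable a b)
      intervalIntegrable_const hpt
  rw [intervalIntegral.integral_const, smul_eq_mul] at hmono
  have hy' : (b - a)⁻¹ * (∫ t in a..b, β t) ^ 2 = (b - a) * y ^ 2 := by
    rw [hy]
    field_simp
  rw [hy']
  nlinarith [hmono, hba]

/-- The dyadic nodes increase. [folklore] -/
theorem rnode_mono (m : ℕ) {j k : ℕ} (h : j ≤ k) : rnode m j ≤ rnode m k := by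
  unfold rnode
  exact div_le_div_of_nonneg_right (Nat.cast_le.2 h) (by positivity)

/-- **Full dyadic cells of `[0, s]`.** For an `L`-Lipschitz, `B`-bounded continuous `β` on
`[0, s]`: `½ ∫₀ˢ β² - 2^{-m} (B² + s L²) ≤ Σ_{k < ⌊s 2^m⌋} 2^m (∫_{t_k}^{t_{k+1}} β)²`.
[folklore] -/
theorem sum_sq_cellIntegral_ge {β : ℝ → ℝ} (hβ : Continuous β) {s L B : ℝ} (hs0 : 0 ≤ s)
    (hL0 : 0 ≤ L) (hL : ∀ t ∈ Icc 0 s, ∀ u ∈ Icc 0 s, |β t - β u| ≤ L * |t - u|)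
    (hB : ∀ t ∈ Icc 0 s, |β t| ≤ B) (m : ℕ) :
    (1 / 2) * (∫ t in (0 : ℝ)..s, β t ^ 2) - ((2 : ℝ) ^ m)⁻¹ * (B ^ 2 + s * L ^ 2) ≤
      ∑ k ∈ Finset.range (Nat.floor (s * 2 ^ m)),
        2 ^ m * (∫ t in rnode m k..rnode m (k + 1), β t) ^ 2 := by
  set K := Nat.floor (s * 2 ^ m) with hK
  have h2m : (0 : ℝ) < 2 ^ m := by positivity
  have hKle : (K : ℝ) ≤ s * 2 ^ m := Nat.floor_le (by positivity)
  have hKlt : s * 2 ^ m < K + 1 := Nat.lt_floor_add_one _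
  have htK : rnode m K ≤ s := by
    unfold rnode
    rw [div_le_iff₀ h2m]
    exact hKle
  have hsK : s - rnode m K ≤ ((2 : ℝ) ^ m)⁻¹ := by
    have h1 : s ≤ (K + 1) / 2 ^ m := by
      rw [le_div_iff₀ h2m]
      exact hKlt.le
    unfold rnode
    rw [add_div] at h1
    rw [inv_eq_one_div]
    linarith
  have hint2 : ∀ a b : ℝ, IntervalIntegrable (fun t => β t ^ 2) volume a b := fun a b =>
    (hβ.pow 2).intervalIntegrable a b
  -- per cell
  have hcell : ∀ k ∈ Finset.range K,
      (1 / 2) * (∫ t in rnode m k..rnode m (k + 1), β t ^ 2) -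
          ((2 : ℝ) ^ m)⁻¹ * (L * ((2 : ℝ) ^ m)⁻¹) ^ 2 ≤
        2 ^ m * (∫ t in rnode m k..rnode m (k + 1), β t) ^ 2 := by
    intro k hk
    rw [Finset.mem_range] at hk
    have hwid : rnode m (k + 1) - rnode m k = ((2 : ℝ) ^ m)⁻¹ := by
      rw [rnode_succ_sub, one_div]
    have hab : rnode m k < rnode m (k + 1) := by
      have : (0 : ℝ) < ((2 : ℝ) ^ m)⁻¹ := by positivity
      linarith
    have hsub : Icc (rnode m k) (rnode m (k + 1)) ⊆ Icc 0 s :=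
      Icc_subset_Icc (rnode_nonneg m k) ((rnode_mono m (Nat.succ_le_of_lt hk)).trans htK)
    have hosc : ∀ t ∈ Icc (rnode m k) (rnode m (k + 1)), ∀ u ∈ Icc (rnode m k) (rnode m (k + 1)),
        |β t - β u| ≤ L * ((2 : ℝ) ^ m)⁻¹ := by
      intro t ht u hu
      refine (hL t (hsub ht) u (hsub hu)).trans (mul_le_mul_of_nonneg_left ?_ hL0)
      rw [abs_le]
      constructor <;> linarith [ht.1, ht.2, hu.1, hu.2]
    have h := sq_integral_ge_cell hβ hab hosc
    rw [hwid, inv_inv] at h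
    exact h
  have hsum := Finset.sum_le_sum hcell
  rw [Finset.sum_sub_distrib, Finset.sum_const, Finset.card_range, ← Finset.mul_sum, nsmul_eq_mul,
    intervalIntegral.sum_integral_adjacent_intervals (fun k _ => hint2 _ _), rnode_zero] at hsum
  -- the incomplete last cell
  have htail : ∫ t in rnode m K..s, β t ^ 2 ≤ ((2 : ℝ) ^ m)⁻¹ * B ^ 2 := by
    have hmono : ∫ t in rnode m K..s, β t ^ 2 ≤ ∫ _ in rnode m K..s, B ^ 2 :=
      intervalIntegral.integral_mono_on htK (hint2 _ _) intervalIntegrable_const fun t ht => by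
        have hb := abs_le.1 (hB t ⟨(rnode_nonneg m K).trans ht.1, ht.2⟩)
        exact sq_le_sq' hb.1 hb.2
    rw [intervalIntegral.integral_const, smul_eq_mul] at hmono
    exact hmono.trans (mul_le_mul_of_nonneg_right hsK (sq_nonneg B))
  have hsplit : ∫ t in (0 : ℝ)..s, β t ^ 2 =
      (∫ t in (0 : ℝ)..rnode m K, β t ^ 2) + ∫ t in rnode m K..s, β t ^ 2 :=
    (intervalIntegral.integral_add_adjacent_intervals (hint2 _ _) (hint2 _ _)).symm
  have hKc : (K : ℝ) * (((2 : ℝ) ^ m)⁻¹ * (L * ((2 : ℝ) ^ m)⁻¹) ^ 2) ≤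
      ((2 : ℝ) ^ m)⁻¹ * (s * L ^ 2) := by
    have h1 : (K : ℝ) * ((2 : ℝ) ^ m)⁻¹ ≤ s := by
      rw [← div_eq_mul_inv, div_le_iff₀ h2m]
      exact hKle
    have h2 : ((2 : ℝ) ^ m)⁻¹ ≤ 1 := inv_le_one_of_one_le₀ (one_le_pow₀ (by norm_num))
    have h3 : (0 : ℝ) ≤ ((2 : ℝ) ^ m)⁻¹ := by positivity
    calc (K : ℝ) * (((2 : ℝ) ^ m)⁻¹ * (L * ((2 : ℝ) ^ m)⁻¹) ^ 2)
        = ((K : ℝ) * ((2 : ℝ) ^ m)⁻¹) * L ^ 2 * ((2 : ℝ) ^ m)⁻¹ * ((2 : ℝ) ^ m)⁻¹ := by ring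
      _ ≤ s * L ^ 2 * ((2 : ℝ) ^ m)⁻¹ * 1 :=
          mul_le_mul (mul_le_mul_of_nonneg_right
            (mul_le_mul_of_nonneg_right h1 (sq_nonneg L)) h3) h2 h3
            (mul_nonneg (mul_nonneg hs0 (sq_nonneg L)) h3)
      _ = ((2 : ℝ) ^ m)⁻¹ * (s * L ^ 2) := by ring
  have hB2 : (0 : ℝ) ≤ ((2 : ℝ) ^ m)⁻¹ * B ^ 2 := by positivity
  rw [hsplit]
  linarith [hsum, htail, hKc, hB2]

/-- `⌊s 2^m⌋ ≤ 2^m` for `s ≤ 1`. [folklore] -/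
theorem floor_mul_two_pow_le {s : ℝ} (hs0 : 0 ≤ s) (hs1 : s ≤ 1) (m : ℕ) :
    Nat.floor (s * 2 ^ m) ≤ 2 ^ m := by
  have h : s * 2 ^ m < ((2 ^ m + 1 : ℕ) : ℝ) := by
    push_cast
    nlinarith [pow_pos (show (0 : ℝ) < 2 by norm_num) m]
  have := (Nat.floor_lt (by positivity)).2 h
  omega

/-- The nodes of the full cells of `[0, s]` lie in `[0, s]`: `t_{k+1} ≤ s` for `k < ⌊s 2^m⌋`.
[folklore] -/
theorem rnode_succ_le_of_lt_floor {s : ℝ} (hs0 : 0 ≤ s) (m : ℕ) {k : ℕ}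
    (hk : k < Nat.floor (s * 2 ^ m)) : rnode m (k + 1) ≤ s := by
  have h2m : (0 : ℝ) < 2 ^ m := by positivity
  have hKle : (Nat.floor (s * 2 ^ m) : ℝ) ≤ s * 2 ^ m := Nat.floor_le (by positivity)
  refine (rnode_mono m (Nat.succ_le_of_lt hk)).trans ?_
  unfold rnode
  rw [div_le_iff₀ h2m]
  exact hKle

end Riemann

/-! ## 2. The harmonic skeleton Gram form, bath by bath -/

section GramForm

variable (ω₂ γ : ℝ) (N : ℕ)

/-- `B_λ = ‖λ‖ e^{‖𝒢‖}`: a sup bound of the harmonic costate on `[0, s] ⊆ [0, 1]`. [folklore] -/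
def harmCostateSup (l : PhaseSpace N) : ℝ := ‖l‖ * Real.exp ‖harmCoDriftLin ω₂ γ N‖

/-- `L_λ = ‖𝒢‖ B_λ`: a Lipschitz bound of the harmonic costate on `[0, s] ⊆ [0, 1]`. [folklore] -/
def harmCostateLip (l : PhaseSpace N) : ℝ := ‖harmCoDriftLin ω₂ γ N‖ * harmCostateSup ω₂ γ N l

/-- `E(λ) = B_λ² + s L_λ²`: the `2^{-m}`-coefficient of the Riemann-sampling error. [folklore] -/
def harmGramErr (s : ℝ) (l : PhaseSpace N) : ℝ :=
  harmCostateSup ω₂ γ N l ^ 2 + s * harmCostateLip ω₂ γ N l ^ 2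

/-- `E(λ) ≤ e^{2‖𝒢‖} (1 + ‖𝒢‖²) ‖λ‖²` for `s ≤ 1`: quadratic in `λ`. [folklore] -/
theorem harmGramErr_le {s : ℝ} (hs1 : s ≤ 1) (l : PhaseSpace N) :
    harmGramErr ω₂ γ N s l ≤
      Real.exp ‖harmCoDriftLin ω₂ γ N‖ ^ 2 * (1 + ‖harmCoDriftLin ω₂ γ N‖ ^ 2) * ‖l‖ ^ 2 := by
  unfold harmGramErr harmCostateLip harmCostateSup
  have h1 : 0 ≤ (‖harmCoDriftLin ω₂ γ N‖ * (‖l‖ * Real.exp ‖harmCoDriftLin ω₂ γ N‖)) ^ 2 :=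
    sq_nonneg _
  nlinarith

variable {ω₂ γ} (hω : 0 < ω₂) (hγ : 0 ≤ γ) {N}

include hω hγ

/-- **The harmonic skeleton Gram form of one bath dominates the observation energy of the
costate**, up to `O(2^{-m})`: if the cells `ι k` of the skeleton pair to `λ` by the cell formula of
bath `b` with amplitude `amp` (parts U-c), then for `0 < s ≤ 1` and every level `m`
`amp² (½ ∫₀ˢ ((c_λ(t)).2 b)² dt - 2^{-m} E(λ)) ≤ 2^{-m} Σ_k ⟨λ, w_{ι k}(s)⟩²`. [folklore] -/
theorem harmonic_skelGramForm_ge {X : Type} [NormedAddCommGroup X] [NormedSpace ℝ X]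
    [CompleteSpace X] (z : PhaseSpace N) {η₀ : ℝ → Fin N → ℝ} (hη₀ : Continuous η₀)
    (H : X →L[ℝ] C(I, Fin N → ℝ)) (x : X) (m : ℕ) (ι : Fin (2 ^ m) → X) (b : Fin N) (amp : ℝ)
    {s : ℝ} (hs0 : 0 < s) (hs1 : s ≤ 1) (l : PhaseSpace N)
    (hcell : ∀ k : Fin (2 ^ m), rnode m (k + 1) ≤ s →
      dualPair l (pinnedChainVariation hω le_rfl le_rfl hγ N z hη₀ H x (ι k) s) =
        amp * 2 ^ m * ∫ t in rnode m k..rnode m (k + 1), (harmCostate ω₂ γ N s l t).2 b) :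
    amp ^ 2 * ((1 / 2) * (∫ t in (0 : ℝ)..s, ((harmCostate ω₂ γ N s l t).2 b) ^ 2) -
        ((2 : ℝ) ^ m)⁻¹ * harmGramErr ω₂ γ N s l) ≤
      ((2 : ℝ) ^ m)⁻¹ *
        ∑ k : Fin (2 ^ m),
          (dualPair l (pinnedChainVariation hω le_rfl le_rfl hγ N z hη₀ H x (ι k) s)) ^ 2 := by
  set β : ℝ → ℝ := fun t => (harmCostate ω₂ γ N s l t).2 b with hβ_def
  have hβ : Continuous β := continuous_harmCostate_snd ω₂ γ N s l b
  have hL0 : 0 ≤ harmCostateLip ω₂ γ N l := by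
    unfold harmCostateLip harmCostateSup
    positivity
  have hL : ∀ t ∈ Icc 0 s, ∀ u ∈ Icc 0 s, |β t - β u| ≤ harmCostateLip ω₂ γ N l * |t - u| :=
    fun t ht u hu => abs_harmCostate_snd_sub_le ω₂ γ N hs1 l b ht hu
  have hB : ∀ t ∈ Icc 0 s, |β t| ≤ harmCostateSup ω₂ γ N l := fun t ht =>
    (abs_snd_apply_le_norm N _ b).trans (norm_harmCostate_le_of_mem ω₂ γ N hs1 ht l)
  have hR := sum_sq_cellIntegral_ge hβ hs0.le hL0 hL hB m
  have hamp : 0 ≤ amp ^ 2 := sq_nonneg amp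
  have h1 := mul_le_mul_of_nonneg_left hR hamp
  refine (le_of_eq (by rfl)).trans (h1.trans ?_)
  -- compare the `ℕ`-indexed Riemann sum with the `Fin`-indexed Gram sum
  set K := Nat.floor (s * 2 ^ m) with hK
  have hKle : K ≤ 2 ^ m := floor_mul_two_pow_le hs0.le hs1 m
  set W : Fin (2 ^ m) → ℝ := fun k =>
    (dualPair l (pinnedChainVariation hω le_rfl le_rfl hγ N z hη₀ H x (ι k) s)) ^ 2 with hW
  set F : ℕ → ℝ := fun i => if h : i < 2 ^ m then ((2 : ℝ) ^ m)⁻¹ * W ⟨i, h⟩ else 0 with hF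
  have hF0 : ∀ i, 0 ≤ F i := by
    intro i
    simp only [hF]
    split_ifs
    · exact mul_nonneg (by positivity) (sq_nonneg _)
    · exact le_rfl
  have hFW : ∑ k : Fin (2 ^ m), ((2 : ℝ) ^ m)⁻¹ * W k = ∑ i ∈ Finset.range (2 ^ m), F i := by
    rw [← Fin.sum_univ_eq_sum_range]
    refine Finset.sum_congr rfl fun k _ => ?_
    simp only [hF, dif_pos k.isLt]
  have hFG : ∀ i ∈ Finset.range K,
      amp ^ 2 * (2 ^ m * (∫ t in rnode m i..rnode m (i + 1), β t) ^ 2) = F i := by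
    intro i hi
    rw [Finset.mem_range] at hi
    have hi2 : i < 2 ^ m := lt_of_lt_of_le hi hKle
    have hks : rnode m (i + 1) ≤ s := rnode_succ_le_of_lt_floor hs0.le m hi
    simp only [hF, dif_pos hi2, hW, hcell ⟨i, hi2⟩ hks]
    field_simp
  calc amp ^ 2 * ∑ k ∈ Finset.range K, 2 ^ m * (∫ t in rnode m k..rnode m (k + 1), β t) ^ 2
      = ∑ i ∈ Finset.range K, F i := by
        rw [Finset.mul_sum]
        exact Finset.sum_congr rfl hFG
    _ ≤ ∑ i ∈ Finset.range (2 ^ m), F i :=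
        Finset.sum_le_sum_of_subset_of_nonneg (Finset.range_mono hKle) fun i _ _ => hF0 i
    _ = ((2 : ℝ) ^ m)⁻¹ * ∑ k : Fin (2 ^ m), W k := by
        rw [← hFW, Finset.mul_sum]

variable (hN : 0 < N) (T_L T_R : ℝ)

/-- **Left bath**: `2γT_L (½ ∫₀ˢ ((c_λ(t)).2 0)² dt - 2^{-m} E(λ)) ≤ 2^{-m} Σ_k ⟨λ, w_{inl k}(s)⟩²`
for the harmonic skeleton Jacobian at level `m`, `0 < s ≤ 1`. [folklore] -/
theorem harmonic_skelGramForm_ge_inl (m : ℕ) (z : PhaseSpace N) (r : WienerPair)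
    (x : PairSkeleton m) {s : ℝ} (hs0 : 0 < s) (hs1 : s ≤ 1) (l : PhaseSpace N) :
    ampL ω₂ 0 0 γ T_L ^ 2 *
        ((1 / 2) * (∫ t in (0 : ℝ)..s, ((harmCostate ω₂ γ N s l t).2 ⟨0, hN⟩) ^ 2) -
          ((2 : ℝ) ^ m)⁻¹ * harmGramErr ω₂ γ N s l) ≤
      ((2 : ℝ) ^ m)⁻¹ * ∑ k : Fin (2 ^ m), (dualPair l (pinnedChainVariation hω le_rfl le_rfl hγ N z
        (continuous_chainNoise_rem ω₂ 0 0 γ N T_L T_R r)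
        (skelForcing N m (ampL ω₂ 0 0 γ T_L) (ampR ω₂ 0 0 γ T_R)) x
        (basisX m (Sum.inl k)) s)) ^ 2 :=
  harmonic_skelGramForm_ge hω hγ z _ _ x m (fun k => basisX m (Sum.inl k)) ⟨0, hN⟩ _ hs0 hs1 l
    fun k hks => harmonic_dualPair_skelVariation_inl hω hγ hN T_L T_R m z r x k hks hs1 l

/-- **Right bath**: the same with `2γT_R`, the cells `inr k` and the momentum component `N-1`.
[folklore] -/
theorem harmonic_skelGramForm_ge_inr (m : ℕ) (z : PhaseSpace N) (r : WienerPair)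
    (x : PairSkeleton m) {s : ℝ} (hs0 : 0 < s) (hs1 : s ≤ 1) (l : PhaseSpace N) :
    ampR ω₂ 0 0 γ T_R ^ 2 *
        ((1 / 2) * (∫ t in (0 : ℝ)..s, ((harmCostate ω₂ γ N s l t).2 ⟨N - 1, by omega⟩) ^ 2) -
          ((2 : ℝ) ^ m)⁻¹ * harmGramErr ω₂ γ N s l) ≤
      ((2 : ℝ) ^ m)⁻¹ * ∑ k : Fin (2 ^ m), (dualPair l (pinnedChainVariation hω le_rfl le_rfl hγ N z
        (continuous_chainNoise_rem ω₂ 0 0 γ N T_L T_R r)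
        (skelForcing N m (ampL ω₂ 0 0 γ T_L) (ampR ω₂ 0 0 γ T_R)) x
        (basisX m (Sum.inr k)) s)) ^ 2 :=
  harmonic_skelGramForm_ge hω hγ z _ _ x m (fun k => basisX m (Sum.inr k)) ⟨N - 1, by omega⟩ _
    hs0 hs1 l fun k hks => harmonic_dualPair_skelVariation_inr hω hγ hN T_L T_R m z r x k hks hs1 l

end GramForm

end Summit.AtomisticToContinuum.FouriersLaw.Theorems.ExtensiveSnapshotIrreversibility.EnergyWindow
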